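import Literature.MathematicalPhysics.QuantumFieldTheory.Balaban1983to89.B8FlatOperatorsTranslateLocal
import Literature.MathematicalPhysics.QuantumFieldTheory.Balaban1983to89.B8CubeMemberTorusClasses

/-!
# `Balaban1983to89.B8CubeMemberTorusSizeLines` — TRANSPLANT STEP T4 (part 2 of 3) of the N05 flat road: THE TWO SIZE LINES OF THE TORUS READING
# [Balaban1984PropagatorsII] (2.136) AT THE CUBE MEMBER OF [Balaban1985RegularSpaces] (1.131) — `|∂*∂A| ≤ nJ·(…)⁻³` with `nJ := (16(d+1)+1)N` and `|QA| ≤ nB·(…)⁻¹`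
# with `nB := N` for the translated lift `A = g∘φ(· − t)` of a member field satisfying the hypotheses (i)–(iii) of (1.59); deep support; the level slack of a side bond

statement-level skeleton of published theorems with citation tags; proofs where landed; nothing here is a claim about the
Yang–Mills mass gap

CITATION HEADER (lean-in-tree rule).  Cell `pub-ymgap` (YM Track A, HUMAN RULING D-0062), DAG node N05 = [B8], seat `pub-ymgap-dag-n05-c` (g12), `TRANSPLANT-DESIGN.md` step T4.
§1 field-side lemmas on `ℤ^{d+1}` (support within one of `□₀`, a global bound, print's level-0 class, the local bound off `□₀`, the level slack); §2 torus-side lemmas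
(deep support of the translated field, the box of a near point, weights in the global band, ★★ the `J` size line `abs_dcsE_dcE_liftB_le`, ★★ the `B` size line
`abs_QE_liftB_le`, read-outs of `∇A`, `ΔA`).  HONEST SCOPE: dictionary lemmas for the consumer `B8Ineq159FlatCubeMemberTransplant.ineq159FlatCubeMemberPrinted_holds`;
count-neutral; nothing continuum ∕ ℝ⁴ ∕ OS ∕ mass-gap ∕ Clay.  Unit `pub-ymgap-dag-n05-c` (g12), 2026-08-28.
-/
noncomputable section

namespace Literature.MathematicalPhysics.QuantumFieldTheory.Balaban1983to89.B8CubeMemberTorusSizeLines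

open B7Prop1Explicit (e e_apply)
open B7Prop1Local (InBox)
open B8Ineq132 (covDerivFwd covDeriv BondTouches PlaqTouches)
open B8Eq146AExpansion (plaqCovDeriv iEta)
open B8Eq155JBound (Jcur)
open B8Eq138LandauZd (covLap covDivB)
open B8Eq140Level (SideTouches IsSide)
open B8FlatOperatorsTranslateLocal (covDerivFwd_one_translate Jcur_one_translate covLap_one_translate norm_Jcur_one_le_of_near near_of_sideTouches)
open B4Reflection242 (boxDom mem_boxDom)
open B6MultiLevelBoxOperator (N0)
open B6GlobalChartV1 (PV toBox toBox_apply)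
open B6GlobalChartV1L0 (domT blkV1)
open B6SectAOperatorsV1 (dcE dcsE dsE QE RE QE_apply)
open BalabanImbrieJaffe1984to88.BIJ85AxialPropagator411 (BondSpace)
open B6GradLegKLevelV1 (DV)
open B6CubeWindowV1 (GlobalBand)
open LatticeFieldCalculus (laplace bondAvgIter)
open B8Eq131Cubes (cube sqLo sqHi inLo inHi)
open B8Eq131CubesAdmissible (cubeFam cubeFam_false_of_le cubeFam_false_zero smul_mem_cube_iff smul_mem_cube_succ_iff)
open B8CubeMemberZd (cubeLamS)
open B8CubeMemberBoxDomains (shift boxP collar_gap)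
open B8CubeMemberBoxDomainsL0 (levL0 levL0_le)
open B8CubeMemberTorusDomainsL0 (cubeTDomainsL0 torP torP_apply N0_torP_eq_sitesPerDir exists_torP_ge siteDeep_shift_of_mem_cube_zero)
open B8CubeMemberTorusChart (toTorus labels labels_toTorus DeepSupp liftB liftB_apply DV_liftB laplace_liftB dcsE_dcE_liftB)
open B8CubeMemberTorusAverages (labelsJ labelsJ_zero norm_bondAvgIter_liftB_le linCovIter_one_translate)
open B8CubeMemberTorusClasses (shiftJ shift_eq_smul_shiftJ lamBond_iff labelsJ_tgt_of_lamBond lamBond_zero_iff len_blkV1_member le_levL0_labels_iff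
  labelsJ_shift_of_lt)
open B8Ineq159FlatCubeMemberPrinted (Ineq159FlatCubeMemberPrinted cubeLamBP mem_cubeLamBP_iff)
open B8Eq138LandauZd (IsLandau138)
open B7Prop4GeneralLevels (linCovIter linCovIter_zero)


variable {d : ℕ}

/-! ## §1 Field-side lemmas on `ℤ^{d+1}`: support, a global bound, print's level-0 class, the local bound off `□₀` -/

section FieldSide

variable {ℓ : ℕ}

/-- **THE SUPPORT OF THE MEMBER's FIELD IS WITHIN SUP-DISTANCE ONE OF `□₀`**: a bond off every `p ∩ □_j ≠ ∅` plaquette carries `φ = 0` (hypothesis of the member), and a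
side of a plaquette touching `□_j ⊂ □₀` is within one of `□₀`. [cite: Balaban1985RegularSpaces, p.77 (convention before (1.5)), (1.131) p.99] -/
theorem exists_near_of_ne_zero (a : Fin (d + 1) → ℤ) {M ρ k m : ℕ} (hmk : m ≤ k) {φ : (Fin (d + 1) → ℤ) → Fin (d + 1) → ℂ}
    (hsupp : ∀ y τ, (∀ j ≤ m, ¬ SideTouches (cubeFam false (ℓ + 1) a M ρ k j) y τ) → φ y τ = 0)
    {z : Fin (d + 1) → ℤ} {τ : Fin (d + 1)} (hz : φ z τ ≠ 0) :
    ∃ s ∈ cube (ℓ + 1) a M ρ k 0, ∀ i, |z i - s i| ≤ 1 := by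
  by_contra hno
  push Not at hno
  apply hz
  refine hsupp z τ fun j hj hs => ?_
  obtain ⟨⟨s, hs', hclose⟩, -⟩ := near_of_sideTouches hs
  rw [cubeFam_false_of_le _ a M ρ (hj.trans hmk)] at hs'
  obtain ⟨i, hi⟩ := hno s (B8Eq131Cubes.cube_anti (Nat.zero_le j) (hj.trans hmk) hs')
  exact absurd (hclose i) (not_le.mpr hi)

/-- **A FIELD SUPPORTED NEAR `□₀` IS BOUNDED** (finite support). [folklore] [cite: Balaban1985RegularSpaces, (1.131) p.99, dictionary] -/
theorem exists_bound_of_near (a : Fin (d + 1) → ℤ) {M ρ k : ℕ} {φ : (Fin (d + 1) → ℤ) → Fin (d + 1) → ℂ}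
    (hnear : ∀ z τ, φ z τ ≠ 0 → ∃ s ∈ cube (ℓ + 1) a M ρ k 0, ∀ i, |z i - s i| ≤ 1) :
    ∃ Mφ : ℝ, 0 ≤ Mφ ∧ ∀ z τ, ‖φ z τ‖ ≤ Mφ := by
  classical
  have hfin : {z : Fin (d + 1) → ℤ | InBox (fun i => B8Eq191FlatDirichletDepth.loC (ℓ + 1) a ρ k 0 i - 1)
      (fun i => B8Eq191FlatDirichletDepth.hiC (ℓ + 1) a M ρ k 0 i + 1) z}.Finite := B8Eq191FlatLettersCubeMember.inBox_finite _ _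
  refine ⟨∑ z ∈ hfin.toFinset, ∑ τ' : Fin (d + 1), ‖φ z τ'‖, Finset.sum_nonneg fun _ _ => Finset.sum_nonneg fun _ _ => norm_nonneg _,
    fun z τ' => ?_⟩
  by_cases hz : φ z τ' = 0
  · rw [hz, norm_zero]; exact Finset.sum_nonneg fun _ _ => Finset.sum_nonneg fun _ _ => norm_nonneg _
  · have hmem : z ∈ hfin.toFinset := by
      rw [Set.Finite.mem_toFinset]
      obtain ⟨s', hs', hclose⟩ := hnear z τ' hz
      rw [B8Eq191FlatDirichletDepth.mem_cube_iff_inBox a M ρ (Nat.zero_le k)] at hs'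
      intro i
      have hc := abs_le.mp (hclose i)
      obtain ⟨h1, h2⟩ := hs' i
      constructor <;> simp only <;> linarith
    calc ‖φ z τ'‖ ≤ ∑ τ'' : Fin (d + 1), ‖φ z τ''‖ := Finset.single_le_sum (fun _ _ => norm_nonneg _) (Finset.mem_univ τ')
      _ ≤ ∑ z' ∈ hfin.toFinset, ∑ τ'' : Fin (d + 1), ‖φ z' τ''‖ :=
          Finset.single_le_sum (f := fun z' => ∑ τ'' : Fin (d + 1), ‖φ z' τ''‖) (fun _ _ => Finset.sum_nonneg fun _ _ => norm_nonneg _) hmem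

/-- `y ∈ □₀ ↔ y ∈ [sqLo 0, sqHi 0]` (plumbing). [cite: Balaban1985RegularSpaces, (1.131) p.99, dictionary] -/
private theorem mem_cube_zero_iff (a : Fin (d + 1) → ℤ) (M ρ k : ℕ) (y : Fin (d + 1) → ℤ) :
    y ∈ cube (ℓ + 1) a M ρ k 0 ↔ InBox (sqLo (ℓ + 1) a ρ k 0) (sqHi (ℓ + 1) a M ρ k 0) y := by
  have h := smul_mem_cube_iff (Nat.succ_pos ℓ) a M ρ k 0 y
  rwa [pow_zero, one_smul] at h

/-- `y ∈ □₁ ↔ y ∈ [inLo 0, inHi 0]` (plumbing). [cite: Balaban1985RegularSpaces, (1.131) p.99, dictionary] -/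
private theorem mem_cube_one_iff (a : Fin (d + 1) → ℤ) (M ρ : ℕ) {k : ℕ} (hk : 0 < k) (y : Fin (d + 1) → ℤ) :
    y ∈ cube (ℓ + 1) a M ρ k 1 ↔ InBox (inLo (ℓ + 1) a ρ k 0) (inHi (ℓ + 1) a M ρ k 0) y := by
  have h := smul_mem_cube_succ_iff (Nat.succ_pos ℓ) a M ρ hk y
  rwa [pow_zero, one_smul] at h

/-- **A BOND TOUCHING `□₀` WITH BOTH ENDS OFF `□₁` BELONGS TO PRINT's LEVEL-0 CLASS `cubeLamBP … 0`**. [cite: Balaban1985RegularSpaces, (1.131) p.99 («Λ′₀ = T ∖ □₁»);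
Balaban1984PropagatorsII, (2.3) p.224] -/
private theorem mem_cubeLamBP_zero (a : Fin (d + 1) → ℤ) (M ρ : ℕ) {k : ℕ} (hk : 0 < k) (m : ℕ) {y : Fin (d + 1) → ℤ} {τ : Fin (d + 1)}
    (hbt : BondTouches (cube (ℓ + 1) a M ρ k 0) y τ) (h1 : y ∉ cube (ℓ + 1) a M ρ k 1) (h2 : y + e τ ∉ cube (ℓ + 1) a M ρ k 1) :
    (y, τ) ∈ cubeLamBP (ℓ + 1) a M ρ k m 0 := by
  rw [mem_cubeLamBP_iff]
  refine ⟨Nat.zero_le m, ?_, fun _ => ⟨fun h => h1 ((mem_cube_one_iff a M ρ hk y).2 h), fun h => h2 ((mem_cube_one_iff a M ρ hk _).2 h)⟩⟩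
  rcases hbt with h | h
  · exact Or.inl ((mem_cube_zero_iff a M ρ k y).1 h)
  · exact Or.inr ((mem_cube_zero_iff a M ρ k _).1 h)

/-- `η‖φ(b)‖ ≤ N` on a bond touching `□₀` with both ends off `□₁`, by hypothesis (ii) of the member at level `0` (`Q₀ = 1`).
[cite: Balaban1985RegularSpaces, (1.59) p.86 (hypothesis «|Q_j(iηφ)| ≤ …» at j = 0), (1.131) p.99] -/
private theorem eta_norm_le_of_touches {η : ℝ} (hη : 0 ≤ η) (a : Fin (d + 1) → ℤ) (M ρ : ℕ) {k : ℕ} (hk : 0 < k) (m : ℕ)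
    {φ : (Fin (d + 1) → ℤ) → Fin (d + 1) → ℂ} {N : ℝ}
    (hQ0 : ∀ c ∈ cubeLamBP (ℓ + 1) a M ρ k m 0, ‖linCovIter (ℓ + 1) (1 : (Fin (d + 1) → ℤ) → Fin (d + 1) → ℂˣ) (iEta η φ) 0 c.1 c.2‖ ≤ N)
    {y : Fin (d + 1) → ℤ} {τ : Fin (d + 1)} (hbt : BondTouches (cube (ℓ + 1) a M ρ k 0) y τ) (h1 : y ∉ cube (ℓ + 1) a M ρ k 1)
    (h2 : y + e τ ∉ cube (ℓ + 1) a M ρ k 1) : η * ‖φ y τ‖ ≤ N := by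
  have h := hQ0 (y, τ) (mem_cubeLamBP_zero a M ρ hk m hbt h1 h2)
  rw [linCovIter_zero] at h
  have hn : ‖iEta η φ y τ‖ = η * ‖φ y τ‖ := by
    simp only [iEta, norm_smul, norm_mul, Complex.norm_I, one_mul, Complex.norm_real, Real.norm_of_nonneg hη]
  rw [← hn]; exact h

/-- ★ **THE LOCAL BOUND OFF `□₀`**: if `x ∉ □₀`, every bond `⟨y′, τ′⟩` with `|y′ − x|_∞ ≤ 1` has `η‖φ(y′, τ′)‖ ≤ N` — both its ends are off `□₁` (collar `ρ ≥ 3`), so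
either it touches `□₀` and hypothesis (ii) at level `0` applies, or hypothesis (iii) does. [cite: Balaban1985RegularSpaces, (1.59) p.86, (1.131) p.99, (1.5) p.77] -/
theorem eta_norm_le_of_near_not_mem {η : ℝ} (hη : 0 ≤ η) (a : Fin (d + 1) → ℤ) (M : ℕ) {ρ k : ℕ} (hk : 0 < k) (hρ3 : 3 ≤ ρ) (m : ℕ)
    {φ : (Fin (d + 1) → ℤ) → Fin (d + 1) → ℂ} {N : ℝ}
    (hQ0 : ∀ c ∈ cubeLamBP (ℓ + 1) a M ρ k m 0, ‖linCovIter (ℓ + 1) (1 : (Fin (d + 1) → ℤ) → Fin (d + 1) → ℂˣ) (iEta η φ) 0 c.1 c.2‖ ≤ N)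
    (hout : ∀ y τ, ¬ BondTouches (cubeFam false (ℓ + 1) a M ρ k 0) y τ → η * ‖φ y τ‖ ≤ N)
    {x : Fin (d + 1) → ℤ} (hx0 : x ∉ cube (ℓ + 1) a M ρ k 0) {y' : Fin (d + 1) → ℤ} (hy' : ∀ i, |y' i - x i| ≤ 1) (τ' : Fin (d + 1)) :
    η * ‖φ y' τ'‖ ≤ N := by
  -- points within sup-distance two of `x ∉ □₀` are off `□₁`
  have hfar : ∀ z : Fin (d + 1) → ℤ, (∀ i, |z i - x i| ≤ 2) → z ∉ cube (ℓ + 1) a M ρ k 1 := by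
    intro z hz hz1
    obtain ⟨i, hi⟩ := collar_gap a hk hx0 hz1
    rw [pow_zero, mul_one, abs_sub_comm] at hi
    have h3 : (3 : ℤ) ≤ (ρ : ℤ) := by exact_mod_cast hρ3
    linarith [hz i]
  have hy'1 : y' ∉ cube (ℓ + 1) a M ρ k 1 := hfar y' fun i => (hy' i).trans (by norm_num)
  have hy'e : y' + e τ' ∉ cube (ℓ + 1) a M ρ k 1 := hfar _ fun i => by
    have h := abs_le.mp (hy' i)
    rw [Pi.add_apply, e_apply]
    split_ifs <;> (rw [abs_le]; constructor <;> linarith)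
  by_cases hbt : BondTouches (cube (ℓ + 1) a M ρ k 0) y' τ'
  · exact eta_norm_le_of_touches hη a M ρ hk m hQ0 hbt hy'1 hy'e
  · exact hout y' τ' (by rwa [cubeFam_false_zero])

/-- **THE LEVEL SLACK OF A SIDE BOND**: a point within sup-distance one of `□_j` lies in `□_{j−1}` (collar `ρL^{j−1} ≥ 1`), so `j ≤ levL0(y + t) + 1` (`j ≤ n`).
[cite: Balaban1985RegularSpaces, (1.131) p.99, (1.5) p.77; Balaban1984PropagatorsII, (2.3)–(2.4) p.224] -/
theorem le_levL0_translate_add_one {Mh : ℕ} (a : Fin (d + 1) → ℤ) (M : ℕ) {ρ k n j : ℕ} (hρL : ℓ + 1 ≤ ρ) (hnk : n ≤ k) (hjn : j ≤ n)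
    {s y : Fin (d + 1) → ℤ} (hs : s ∈ cube (ℓ + 1) a M ρ k j) (hy : ∀ i, |y i - s i| ≤ 1) :
    j ≤ levL0 ℓ Mh a M ρ k n (y + shift ℓ Mh a ρ k n) + 1 := by
  rcases Nat.lt_or_ge 1 j with hj2 | hj1
  · have hyj : y ∈ cube (ℓ + 1) a M ρ k (j - 1) := by
      by_contra hy'
      obtain ⟨i, hi⟩ := collar_gap a (show j - 1 < k by omega) hy' (show s ∈ cube (ℓ + 1) a M ρ k (j - 1 + 1) by
        rw [Nat.sub_add_cancel (by omega)]; exact hs)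
      have h1 : 1 ≤ ρ * (ℓ + 1) ^ (j - 1) := Nat.mul_pos (by omega) (Nat.pow_pos (Nat.succ_pos ℓ))
      have h1z : (1 : ℤ) ≤ (ρ : ℤ) * (((ℓ + 1 : ℕ) : ℤ)) ^ (j - 1) := by exact_mod_cast h1
      linarith [hy i]
    have h := (B8CubeMemberBoxDomainsL0.le_levL0_iff (ℓ := ℓ) (Mh := Mh) a M hρL hnk (show 1 ≤ j - 1 by omega) (show j - 1 ≤ n by omega)
      (y + shift ℓ Mh a ρ k n)).2 (by rw [add_sub_cancel_right]; exact hyj)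
    omega
  · omega

end FieldSide

/-! ## §2 Torus-side lemmas: deep support, the box of a near point, the two size lines of the reading, the three read-outs -/

section TorusSide

variable {ℓ mV KV : ℕ} {hd : 1 ≤ d + 1} {hL : Odd (ℓ + 1) ∧ 1 < ℓ + 1}

/-- **THE TRANSLATED FIELD IS `(ρLⁿ − 2)`-DEEPLY SUPPORTED IN THE HOST BOX** (its support is within one of `t + □₀`, which is `ρLⁿ`-deep).
[cite: Balaban1984PropagatorsII, (2.1) p.224, (2.36) p.229; Balaban1985RegularSpaces, (1.131) p.99, p.98] -/
theorem deepSupp_translate (hℓ : 1 ≤ ℓ) {Mh : ℕ} (hMh : 2 ≤ Mh) (a : Fin (d + 1) → ℤ) {M ρ k n : ℕ} (hn : 1 ≤ n) (hnk : n ≤ k)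
    {P : Fin (d + 1) → ℕ} (hfit : ∀ μ, boxP ℓ M ρ k n μ ≤ P μ) (hN : ∀ μ, N0 ℓ Mh n P μ = (PV d ℓ mV KV hd hL).sitesPerDir 0)
    {φ : (Fin (d + 1) → ℤ) → Fin (d + 1) → ℂ} (hnear : ∀ z τ, φ z τ ≠ 0 → ∃ s ∈ cube (ℓ + 1) a M ρ k 0, ∀ i, |z i - s i| ≤ 1) :
    DeepSupp ((PV d ℓ mV KV hd hL).sitesPerDir 0) (((ρ * (ℓ + 1) ^ n : ℕ) : ℤ) - 2) (fun w => φ (w - shift ℓ Mh a ρ k n)) := by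
  intro w hw μ
  have hw' : ∃ τ, φ (w - shift ℓ Mh a ρ k n) τ ≠ 0 := by
    by_contra h; push Not at h; exact hw (funext h)
  obtain ⟨τ, hτ⟩ := hw'
  obtain ⟨s, hs, hclose⟩ := hnear _ τ hτ
  have hdeep := siteDeep_shift_of_mem_cube_zero hℓ hMh a hn hnk hfit hs μ
  rw [hN μ] at hdeep
  have hc := abs_le.mp (hclose μ)
  simp only [Pi.add_apply, Pi.sub_apply] at hdeep hc
  constructor <;> omega

/-- **A POINT WITHIN ONE OF `□₀`, TRANSLATED BY `t`, LIES IN THE FUNDAMENTAL BOX `[0, N)` OF THE HOST**. [cite: Balaban1984PropagatorsII, (2.1) p.224; Balaban1985RegularSpaces, p.98] -/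
theorem box_of_near_cube_zero (hℓ : 1 ≤ ℓ) {Mh : ℕ} (hMh : 2 ≤ Mh) (a : Fin (d + 1) → ℤ) {M ρ k n : ℕ} (hn : 1 ≤ n) (hnk : n ≤ k) (hρ0 : 0 < ρ)
    {P : Fin (d + 1) → ℕ} (hfit : ∀ μ, boxP ℓ M ρ k n μ ≤ P μ) (hN : ∀ μ, N0 ℓ Mh n P μ = (PV d ℓ mV KV hd hL).sitesPerDir 0)
    {s : Fin (d + 1) → ℤ} (hs : s ∈ cube (ℓ + 1) a M ρ k 0) {y : Fin (d + 1) → ℤ} (hy : ∀ i, |y i - s i| ≤ 1) (μ : Fin (d + 1)) :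
    0 ≤ (y + shift ℓ Mh a ρ k n) μ ∧ (y + shift ℓ Mh a ρ k n) μ < ((PV d ℓ mV KV hd hL).sitesPerDir 0 : ℕ) := by
  have hdeep := siteDeep_shift_of_mem_cube_zero hℓ hMh a hn hnk hfit hs μ
  rw [hN μ] at hdeep
  have hc := abs_le.mp (hy μ)
  have h2 : 2 ≤ ρ * (ℓ + 1) ^ n :=
    le_trans (le_trans (by omega : 2 ≤ ℓ + 1) (Nat.le_self_pow (by omega : n ≠ 0) (ℓ + 1))) (Nat.le_mul_of_pos_left _ hρ0)
  simp only [Pi.add_apply] at hdeep ⊢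
  constructor <;> omega

/-- **POSITIVE WEIGHTS IN THE GLOBAL BAND `[1, 1]`**: `w(i) := (L^{j_i})^{d+1}·(c′∕L^{j_i})²`. [cite: Balaban1984PropagatorsII, (2.16) p.225, (2.90) p.239, bookkeeping] -/
theorem globalBand_weights {Dm : B6SectADomainsV1.Domains (PV d ℓ mV KV hd hL)} {η : ℝ} (hη : 0 < η) :
    ∃ w : B6SectAOperatorsV1.BondIdx Dm → ℝ, (∀ i, 0 < w i) ∧ GlobalBand (1 : ℝ) 1 η⁻¹ w := by
  refine ⟨fun i => ((((ℓ + 1 : ℕ) : ℝ)) ^ (i.1.1 : ℕ)) ^ (d + 1) * (η⁻¹ / (((ℓ + 1 : ℕ) : ℝ) ^ (i.1.1 : ℕ))) ^ 2, fun i => ?_, fun i => ?_⟩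
  · have h1 : (0 : ℝ) < (((ℓ + 1 : ℕ) : ℝ)) ^ (i.1.1 : ℕ) := by positivity
    have h2 : 0 < η⁻¹ / (((ℓ + 1 : ℕ) : ℝ) ^ (i.1.1 : ℕ)) := div_pos (inv_pos.2 hη) h1
    show 0 < ((((ℓ + 1 : ℕ) : ℝ)) ^ (i.1.1 : ℕ)) ^ (d + 1) * (η⁻¹ / (((ℓ + 1 : ℕ) : ℝ) ^ (i.1.1 : ℕ))) ^ 2
    positivity
  · have h1 : (0 : ℝ) < (((ℓ + 1 : ℕ) : ℝ)) ^ (i.1.1 : ℕ) := by positivity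
    have h2 : (η⁻¹ / (((ℓ + 1 : ℕ) : ℝ) ^ (i.1.1 : ℕ))) ^ 2 ≠ 0 := (pow_pos (div_pos (inv_pos.2 hη) h1) 2).ne'
    have heq : ((((ℓ + 1 : ℕ) : ℝ)) ^ (i.1.1 : ℕ)) ^ (d + 1) * (η⁻¹ / (((ℓ + 1 : ℕ) : ℝ) ^ (i.1.1 : ℕ))) ^ 2 /
        (η⁻¹ / (((ℓ + 1 : ℕ) : ℝ) ^ (i.1.1 : ℕ))) ^ 2 = ((((ℓ + 1 : ℕ) : ℝ)) ^ (i.1.1 : ℕ)) ^ (d + 1) := by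
      rw [mul_div_assoc, div_self h2, mul_one]
    simp only [heq, one_mul, le_refl, and_self]

section Member

variable {Mh : ℕ} (hℓ : 1 ≤ ℓ) (hMh : 2 ≤ Mh) (a : Fin (d + 1) → ℤ) {M ρ k n R : ℕ} (hn : 1 ≤ n) (hnk : n ≤ k)
  (hρ : Mh * (ℓ + 1) ∣ ρ) (hM : Mh * (ℓ + 1) ∣ M) (hρ0 : 0 < ρ) (hR : R * (Mh * (ℓ + 1)) ≤ ρ)
  {P : Fin (d + 1) → ℕ} (hfit : ∀ μ, boxP ℓ M ρ k n μ ≤ P μ) (hN : ∀ μ, N0 ℓ Mh n P μ = (PV d ℓ mV KV hd hL).sitesPerDir 0) (hk : n ≤ mV + KV)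

/-- ★★ **THE `J` SIZE LINE OF THE READING, `nJ := (16(d+1)+1)·N`**: `|∂*∂A(b)| ≤ nJ·((L^{lev(b)}η⁻¹…)³)⁻¹`-currency, i.e. `(L^{lev}η)³|J(φ)(labels b − t)| ≤ nJ`: at a bond
touching `□_{lev}` this is hypothesis (i) of the member; otherwise `lev = 0`, the bond is off `□₀`, and the local bound (`J` is a double difference over the stencil, every
stencil bond carrying `η|φ| ≤ N`) gives `η³|J| ≤ 16(d+1)N`. [cite: Balaban1985RegularSpaces, (1.59) p.86, (1.55) p.86, (1.131) p.99; Balaban1984PropagatorsII, (2.136) p.247] -/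
theorem abs_dcsE_dcE_liftB_le {η : ℝ} (hη : 0 < η) {φ : (Fin (d + 1) → ℤ) → Fin (d + 1) → ℂ} {N : ℝ} (hN0 : 0 ≤ N) (hρ3 : 3 ≤ ρ)
    (hJ : ∀ j ≤ n, ∀ y τ, BondTouches (cubeFam false (ℓ + 1) a M ρ k j) y τ →
      (((ℓ : ℝ) + 1) ^ j * η) ^ 3 * ‖Jcur η (1 : (Fin (d + 1) → ℤ) → Fin (d + 1) → ℂˣ) φ τ y‖ ≤ N)
    (hQ0 : ∀ c ∈ cubeLamBP (ℓ + 1) a M ρ k n 0, ‖linCovIter (ℓ + 1) (1 : (Fin (d + 1) → ℤ) → Fin (d + 1) → ℂˣ) (iEta η φ) 0 c.1 c.2‖ ≤ N)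
    (hout : ∀ y τ, ¬ BondTouches (cubeFam false (ℓ + 1) a M ρ k 0) y τ → η * ‖φ y τ‖ ≤ N)
    (hψ2 : DeepSupp ((PV d ℓ mV KV hd hL).sitesPerDir 0) 2 (fun w => φ (w - shift ℓ Mh a ρ k n)))
    (h2N : (2 : ℤ) ≤ ((PV d ℓ mV KV hd hL).sitesPerDir 0 : ℕ)) (g : ℂ →ₗ[ℝ] ℝ) (hg : ∀ z, |g z| ≤ ‖z‖)
    (b : PBond (PV d ℓ mV KV hd hL) 0) :
    |(dcsE η⁻¹ (dcE η⁻¹ (WithLp.toLp 2 (liftB (hd := hd) (hL := hL) (mV := mV) (KV := KV) (ℓ := ℓ) g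
        (fun w => φ (w - shift ℓ Mh a ρ k n)))))) b| ≤
      ((16 * ((d : ℝ) + 1) + 1) * N) *
        (((B6Geom246MultiLevelTorusL0.geomT (cubeTDomainsL0 hℓ hMh a hn hnk hρ hM hρ0 hR P hfit)).len
            (blkV1 hN (cubeTDomainsL0 hℓ hMh a hn hnk hρ hM hρ0 hR P hfit) b) * |η⁻¹|⁻¹) ^ 3)⁻¹ := by
  have hMh1 : 1 ≤ Mh := le_trans (by norm_num) hMh
  have hρL : ℓ + 1 ≤ ρ := le_trans (Nat.le_mul_of_pos_left _ hMh1) (Nat.le_of_dvd hρ0 hρ)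
  have h1k : 0 < k := lt_of_lt_of_le hn hnk
  have hcfinv : |η⁻¹|⁻¹ = η := by rw [abs_of_pos (inv_pos.2 hη), inv_inv]
  rw [dcsE_dcE_liftB (le_refl (2 : ℤ)) h2N g hψ2, Jcur_one_translate, len_blkV1_member, hcfinv]
  set x := labels b.src - shift ℓ Mh a ρ k n with hx
  set lv := levL0 ℓ Mh a M ρ k n (labels b.src) with hlv
  have hlvn : lv ≤ n := levL0_le ℓ Mh a M ρ k hn _
  have hwpos : 0 < (((ℓ : ℝ) + 1) ^ lv * η) ^ 3 := by positivity
  have hNle : N ≤ (16 * ((d : ℝ) + 1) + 1) * N := by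
    have : (0 : ℝ) ≤ d := Nat.cast_nonneg _
    nlinarith
  rw [← div_eq_mul_inv, le_div_iff₀ hwpos]
  by_cases htouch : BondTouches (cubeFam false (ℓ + 1) a M ρ k lv) x b.dir
  · have h := hJ lv hlvn x b.dir htouch
    calc |g (Jcur η 1 φ b.dir x)| * ((((ℓ : ℝ) + 1) ^ lv * η) ^ 3)
        ≤ ‖Jcur η 1 φ b.dir x‖ * ((((ℓ : ℝ) + 1) ^ lv * η) ^ 3) := mul_le_mul_of_nonneg_right (hg _) hwpos.le
      _ ≤ N := by linarith [h]
      _ ≤ (16 * ((d : ℝ) + 1) + 1) * N := hNle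
  · -- `lv = 0` and the bond is off `□₀`
    have hlv0 : lv = 0 := by
      by_contra hne
      have hlv1 : 1 ≤ lv := Nat.one_le_iff_ne_zero.mpr hne
      have hxin : x ∈ cube (ℓ + 1) a M ρ k lv := (le_levL0_labels_iff a M hρL hnk hlv1 hlvn b.src).1 le_rfl
      exact htouch (Or.inl (by rw [cubeFam_false_of_le _ a M ρ (hlvn.trans hnk)]; exact hxin))
    have hx0 : x ∉ cube (ℓ + 1) a M ρ k 0 := fun h => htouch (Or.inl (by rw [hlv0, cubeFam_false_zero]; exact h))
    have hnear : ∀ (y' : Fin (d + 1) → ℤ) (τ' : Fin (d + 1)), (∀ i, |y' i - x i| ≤ 1) → ‖φ y' τ'‖ ≤ N * η⁻¹ := by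
      intro y' τ' hy'
      have h := eta_norm_le_of_near_not_mem hη.le a M h1k hρ3 n hQ0 hout hx0 hy' τ'
      rw [← div_eq_mul_inv, le_div_iff₀ hη, mul_comm]; exact h
    have hloc := norm_Jcur_one_le_of_near hη (by positivity : 0 ≤ N * η⁻¹) hnear b.dir
    rw [hlv0, pow_zero, one_mul]
    calc |g (Jcur η 1 φ b.dir x)| * η ^ 3 ≤ ‖Jcur η 1 φ b.dir x‖ * η ^ 3 := mul_le_mul_of_nonneg_right (hg _) (by positivity)
      _ ≤ (16 * ((d : ℝ) + 1) * N * (η ^ 3)⁻¹) * η ^ 3 := mul_le_mul_of_nonneg_right (hloc.trans_eq (by ring)) (by positivity)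
      _ = 16 * ((d : ℝ) + 1) * N := by rw [mul_assoc, inv_mul_cancel₀ (pow_ne_zero 3 hη.ne'), mul_one]
      _ ≤ (16 * ((d : ℝ) + 1) + 1) * N := by nlinarith [hN0]

/-- ★★ **THE `B` SIZE LINE OF THE READING, `nB := N`**: `(Lʲη)|Q_jA(b)| ≤ N` on every index bond `b ∈ Λ_j`: for `j ≥ 1` by the currency lemma (`(Lʲη)|Q_j(g∘ψ)| ≤ |Q_j(iηψ)|` of
[B7] Prop. 4) and the class dictionary `Λ_j ↔ cubeLamBP … j` (hypothesis (ii)); for `j = 0` the index bond has both ends off `t + □₁` and `Q₀ = 1`, so hypothesis (ii) at level `0`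
(if it touches `□₀`) or (iii) applies. [cite: Balaban1985RegularSpaces, (1.59) p.86, (1.131) p.99; Balaban1984PropagatorsII, (2.3) p.224, (2.20) p.226; Balaban1985Averaging, Prop. 4 p.38] -/
theorem abs_QE_liftB_le {η : ℝ} (hη : 0 < η) {φ : (Fin (d + 1) → ℤ) → Fin (d + 1) → ℂ} {N : ℝ}
    (hQ : ∀ j ≤ n, ∀ c ∈ cubeLamBP (ℓ + 1) a M ρ k n j, ‖linCovIter (ℓ + 1) (1 : (Fin (d + 1) → ℤ) → Fin (d + 1) → ℂˣ) (iEta η φ) j c.1 c.2‖ ≤ N)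
    (hout : ∀ y τ, ¬ BondTouches (cubeFam false (ℓ + 1) a M ρ k 0) y τ → η * ‖φ y τ‖ ≤ N)
    {r : ℤ} (hrn : (((ℓ + 1) ^ n : ℕ) : ℤ) ≤ r) (hrN : r ≤ ((PV d ℓ mV KV hd hL).sitesPerDir 0 : ℕ))
    (hψ : DeepSupp ((PV d ℓ mV KV hd hL).sitesPerDir 0) r (fun w => φ (w - shift ℓ Mh a ρ k n)))
    {Mφ : ℝ} (hMφ0 : 0 ≤ Mφ) (hMφ : ∀ z τ, ‖φ z τ‖ ≤ Mφ) (g : ℂ →ₗ[ℝ] ℝ) (hg : ∀ z, |g z| ≤ ‖z‖)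
    (i : B6SectAOperatorsV1.BondIdx (domT hN (cubeTDomainsL0 hℓ hMh a hn hnk hρ hM hρ0 hR P hfit) hk)) :
    |(QE (domT hN (cubeTDomainsL0 hℓ hMh a hn hnk hρ hM hρ0 hR P hfit) hk)
        (WithLp.toLp 2 (liftB (hd := hd) (hL := hL) (mV := mV) (KV := KV) (ℓ := ℓ) g (fun w => φ (w - shift ℓ Mh a ρ k n))))) i| ≤
      N * ((((ℓ : ℝ) + 1) ^ (i.1.1 : ℕ) * |η⁻¹|⁻¹))⁻¹ := by
  have hL1 : 1 ≤ ℓ + 1 := Nat.succ_pos ℓ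
  have hMh1 : 1 ≤ Mh := le_trans (by norm_num) hMh
  have hρL : ℓ + 1 ≤ ρ := le_trans (Nat.le_mul_of_pos_left _ hMh1) (Nat.le_of_dvd hρ0 hρ)
  have h1k : 0 < k := lt_of_lt_of_le hn hnk
  have hcfinv : |η⁻¹|⁻¹ = η := by rw [abs_of_pos (inv_pos.2 hη), inv_inv]
  have hMψ : ∀ w ν, ‖(fun w => φ (w - shift ℓ Mh a ρ k n)) w ν‖ ≤ Mφ := fun w ν => hMφ _ ν
  obtain ⟨⟨⟨jv, hjv⟩, b⟩, hLam⟩ := i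
  have hjn : jv ≤ n := Nat.lt_succ_iff.mp hjv
  rw [QE_apply, hcfinv]
  show |bondAvgIter jv (liftB (hd := hd) (hL := hL) (mV := mV) (KV := KV) (ℓ := ℓ) g (fun w => φ (w - shift ℓ Mh a ρ k n))) b| ≤
    N * ((((ℓ : ℝ) + 1) ^ jv * η))⁻¹
  have hwpos : 0 < ((ℓ : ℝ) + 1) ^ jv * η := by positivity
  rw [← div_eq_mul_inv, le_div_iff₀ hwpos]
  rcases Nat.eq_zero_or_pos jv with hj0 | hjpos
  · -- level `0`: `Q₀ = 1`, the index bond has both ends off `t + □₁`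
    subst hj0
    rw [B5Eq120IterProof.bondAvgIter_zero, liftB_apply, pow_zero, one_mul]
    obtain ⟨hsrc, htgt⟩ := (lamBond_zero_iff hℓ hMh a hn hnk hρ hM hρ0 hR hfit hN hk b).1 hLam
    set x := labels b.src - shift ℓ Mh a ρ k n with hx
    show |g (φ x b.dir)| * η ≤ N
    have hgx : |g (φ x b.dir)| * η ≤ η * ‖φ x b.dir‖ := by rw [mul_comm]; exact mul_le_mul_of_nonneg_left (hg _) hη.le
    refine hgx.trans ?_
    by_cases hbt : BondTouches (cube (ℓ + 1) a M ρ k 0) x b.dir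
    · -- touching `□₀`: the source label is deep, so the target label is the source label `+ e_dir` (no wrap-around)
      have h2ρ : (2 : ℤ) ≤ ((ρ * (ℓ + 1) ^ n : ℕ) : ℤ) := by
        have : 2 ≤ ρ * (ℓ + 1) ^ n := le_trans (by omega : 2 ≤ ρ) (Nat.le_mul_of_pos_right _ (Nat.pow_pos hL1))
        exact_mod_cast this
      have hdeepx : labels b.src b.dir + 1 < ((PV d ℓ mV KV hd hL).sitesPerDir 0 : ℕ) := by
        rcases hbt with h | h
        · have hdp := siteDeep_shift_of_mem_cube_zero hℓ hMh a hn hnk hfit h b.dir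
          rw [hN, hx, sub_add_cancel] at hdp
          linarith [hdp.2]
        · have hdp := siteDeep_shift_of_mem_cube_zero hℓ hMh a hn hnk hfit h b.dir
          rw [hN, hx] at hdp
          simp only [Pi.add_apply, Pi.sub_apply, e_apply, ite_true] at hdp
          linarith [hdp.2]
      have hsrcbox : labels b.tgt = labels b.src + e b.dir := by
        have h := labelsJ_shift_of_lt (j := 0) b.src b.dir (by rw [labelsJ_zero]; exact hdeepx)
        rw [labelsJ_zero, labelsJ_zero] at h
        exact h
      have htgt' : x + e b.dir ∉ cube (ℓ + 1) a M ρ k 1 := by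
        have h : labels b.tgt - shift ℓ Mh a ρ k n = x + e b.dir := by rw [hsrcbox, hx]; abel
        rw [← h]; exact htgt
      exact eta_norm_le_of_touches hη.le a M ρ h1k n (hQ 0 (Nat.zero_le n)) hbt hsrc htgt'
    · exact hout x b.dir (by rwa [cubeFam_false_zero])
  · -- level `jv ≥ 1`: the currency lemma and the class dictionary
    have hjf : jv ≤ mV + KV := hjn.trans hk
    have hrj : (((ℓ + 1) ^ jv : ℕ) : ℤ) ≤ r := le_trans (by exact_mod_cast Nat.pow_le_pow_right hL1 hjn) hrn
    have hcur := norm_bondAvgIter_liftB_le hjf hrj hrN g hg hψ hMφ0 hMψ hη b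
    have htr := linCovIter_one_translate (ℓ := ℓ) (j := jv) φ hMφ0 hMφ hη.le (shiftJ ℓ Mh a ρ k n jv) (labelsJ b.src) b.dir
    have hψeq : (fun w ν => φ (w - (((ℓ + 1) ^ jv : ℕ) : ℤ) • shiftJ ℓ Mh a ρ k n jv) ν) = fun w => φ (w - shift ℓ Mh a ρ k n) := by
      funext w ν; rw [shift_eq_smul_shiftJ ℓ Mh a hjn hnk]
    rw [hψeq] at htr
    rw [htr] at hcur
    have htgt := labelsJ_tgt_of_lamBond hℓ hMh a hn hnk hρ hM hρ0 hR hfit hN hk hjpos hjn hLam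
    have hmem := (lamBond_iff hℓ hMh a hn hnk hρ hM hρ0 hR hfit hN hk hjpos hjn b htgt).1 hLam
    have h := hQ jv hjn _ hmem
    calc |bondAvgIter jv (liftB g (fun w => φ (w - shift ℓ Mh a ρ k n))) b| * (((ℓ : ℝ) + 1) ^ jv * η)
        = ((((ℓ + 1 : ℕ) : ℝ)) ^ jv * η) * |bondAvgIter jv (liftB g (fun w => φ (w - shift ℓ Mh a ρ k n))) b| := by push_cast; ring
      _ ≤ ‖linCovIter (ℓ + 1) 1 (iEta η φ) jv (labelsJ b.src - shiftJ ℓ Mh a ρ k n jv) b.dir‖ := hcur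
      _ ≤ N := h

end Member

/-- **READ-OUT OF `∇A`**: `(DV_ν A)(b) = g(D^η_{1,ν}φ(labels b − t, dir b))` for the translated lift. [cite: Balaban1984PropagatorsII, (2.136) p.247; Balaban1985RegularSpaces, (1.1) p.76] -/
theorem DV_liftB_translate {η : ℝ} {r : ℤ} (hr : 1 ≤ r) (hrN : r ≤ ((PV d ℓ mV KV hd hL).sitesPerDir 0 : ℕ)) (g : ℂ →ₗ[ℝ] ℝ)
    {φ : (Fin (d + 1) → ℤ) → Fin (d + 1) → ℂ} (t : Fin (d + 1) → ℤ) (hψ : DeepSupp ((PV d ℓ mV KV hd hL).sitesPerDir 0) r (fun w => φ (w - t)))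
    (ν : Fin (d + 1)) (b : PBond (PV d ℓ mV KV hd hL) 0) :
    DV ν η⁻¹ (liftB g (fun w => φ (w - t))) b =
      g (covDerivFwd η (1 : (Fin (d + 1) → ℤ) → Fin (d + 1) → ℂˣ) ν (fun z => φ z b.dir) (labels b.src - t)) := by
  rw [DV_liftB hr hrN g hψ]
  exact congrArg g (covDerivFwd_one_translate η φ t ν b.dir (labels b.src))

/-- **READ-OUT OF `ΔA`**: `(Δ A_τ)(x) = g(Δ^η_1 φ_τ(labels x − t))` for the translated lift. [cite: Balaban1984PropagatorsII, (2.136) p.247; Balaban1985BackgroundPropagators, (3.23) p.394] -/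
theorem laplace_liftB_translate {η : ℝ} {r : ℤ} (hr : 1 ≤ r) (hrN : r ≤ ((PV d ℓ mV KV hd hL).sitesPerDir 0 : ℕ)) (g : ℂ →ₗ[ℝ] ℝ)
    {φ : (Fin (d + 1) → ℤ) → Fin (d + 1) → ℂ} (t : Fin (d + 1) → ℤ) (hψ : DeepSupp ((PV d ℓ mV KV hd hL).sitesPerDir 0) r (fun w => φ (w - t)))
    (τ : Fin (d + 1)) (x : Site (PV d ℓ mV KV hd hL) 0) :
    laplace η⁻¹ (fun z => liftB g (fun w => φ (w - t)) ⟨z, τ⟩) x =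
      g (covLap η (1 : (Fin (d + 1) → ℤ) → Fin (d + 1) → ℂˣ) (fun z => φ z τ) (labels x - t)) := by
  rw [laplace_liftB hr hrN g hψ τ x]
  exact congrArg g (covLap_one_translate η t (fun z => φ z τ) (labels x))

end TorusSide

end Literature.MathematicalPhysics.QuantumFieldTheory.Balaban1983to89.B8CubeMemberTorusSizeLines
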